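import Summits.Ventures.PackingBounds.ThreePointCert.SoundExactLift

/-!
# Soundness of the exact three-point certificate checker, III: the sums of squares of `(ii)`

Framing: lottery ticket; floor = certified bounds/negative ranges. Venture `PackingBounds`
(cell `pub-packcert`), three-point SDP family.

Values of the part expansions (`eval_rowPolyX`, `eval_partRows`), composable row-chunk validity
(`PChunkVal`, `PartsValFrom`, `PartsVal`) and nonnegativity of every part (`partVal_nonneg`).
-/

noncomputable section

open Finset
open scoped RealInnerProductSpace

namespace Summit.Ventures.PackingBounds.ThreePointCert

open Literature.Geometry.DiscreteGeometry Literature.Geometry.DiscreteGeometry.PolyCert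
open Literature.Geometry.DiscreteGeometry.PolyCert.SPoly
open Literature.Analysis.SpecialFunctions

/-! ### Values of the parts of `(ii)` -/

/-- Unpacked `partShapeOK`. -/
theorem partShapeOK_spec (Pt : SymPart) (h : partShapeOK Pt = true) :
    LiftOK Pt.V Pt.psd ∧ Pt.bs.length = Pt.V.m ∧ (Pt.two = true → Pt.bs2.length = Pt.V.m) := by
  unfold partShapeOK at h
  simp only [Bool.and_eq_true, decide_eq_true_eq, List.all_eq_true, Bool.or_eq_true, Bool.not_eq_true'] at h
  obtain ⟨⟨⟨⟨h1, h2⟩, h3⟩, h4⟩, h5⟩ := h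
  refine ⟨⟨h1, h2, h5⟩, h3, fun ht => ?_⟩
  rcases h4 with h4 | h4
  · rw [ht] at h4; exact absurd h4 (by decide)
  · exact h4

/-- The value of row `j` of a part: `b_j · Σ_l M_{jl} b_l` (with the weights `3, 1` for two components). -/
def rowValX (Pt : SymPart) (u v t : ℝ) (j : ℕ) : ℝ :=
  if Pt.two then
    3 * (eval (Pt.bs.getD j []) u v t * ∑ l ∈ range Pt.V.m,
        ((Mrow Pt.V (Srows Pt.psd) Pt.psd.f j).getD l 0 : ℝ) * eval (Pt.bs.getD l []) u v t) +
      eval (Pt.bs2.getD j []) u v t * ∑ l ∈ range Pt.V.m,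
        ((Mrow Pt.V (Srows Pt.psd) Pt.psd.f j).getD l 0 : ℝ) * eval (Pt.bs2.getD l []) u v t
  else
    eval (Pt.bs.getD j []) u v t * ∑ l ∈ range Pt.V.m,
      ((Mrow Pt.V (Srows Pt.psd) Pt.psd.f j).getD l 0 : ℝ) * eval (Pt.bs.getD l []) u v t

/-- Value of a linear combination of basis polynomials. -/
theorem eval_linComb (cs : List ℤ) (bs : List SPoly) (hlen : cs.length = bs.length) (u v t : ℝ) :
    eval (linComb cs bs) u v t = ∑ l ∈ range cs.length, (cs.getD l 0 : ℝ) * eval (bs.getD l []) u v t := by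
  unfold linComb
  rw [eval_mergeAllB, sum_map_zipWith _ _ (0 : ℤ) ([] : SPoly) _ _ hlen]
  refine Finset.sum_congr rfl fun l _ => ?_
  rw [eval_smul]

/-- `eval (rowPolyX Pt (Srows Pt.psd) j) = rowValX Pt j` for `j < m`. -/
theorem eval_rowPolyX (Pt : SymPart) (h : partShapeOK Pt = true) (j : ℕ) (hj : j < Pt.V.m) (u v t : ℝ) :
    eval (rowPolyX Pt (Srows Pt.psd) j) u v t = rowValX Pt u v t j := by
  obtain ⟨hL, hbs, hbs2⟩ := partShapeOK_spec Pt h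
  have hM := Mrow_length Pt.V Pt.psd hL j hj
  unfold rowPolyX rowValX
  by_cases htwo : Pt.two = true
  · simp only [htwo, if_true, eval_mergeAll, List.map_cons, List.map_nil, List.sum_cons, List.sum_nil,
      add_zero, eval_smul, eval_mulN]
    rw [eval_linComb _ _ (by rw [hM, hbs]), eval_linComb _ _ (by rw [hM, hbs2 htwo]), hM]
    push_cast; ring
  · simp only [htwo, Bool.false_eq_true, if_false, eval_mulN]
    rw [eval_linComb _ _ (by rw [hM, hbs]), hM]

/-- `eval (partRows Pt j0 cnt) = Σ_{j ∈ [j0, j0+cnt)} rowValX Pt j` when `j0 + cnt ≤ m`. -/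
theorem eval_partRows (Pt : SymPart) (h : partShapeOK Pt = true) (j0 cnt : ℕ) (hc : j0 + cnt ≤ Pt.V.m)
    (u v t : ℝ) : eval (partRows Pt j0 cnt) u v t = ∑ j ∈ Finset.Ico j0 (j0 + cnt), rowValX Pt u v t j := by
  unfold partRows
  rw [eval_mergeAllB, List.map_map, list_sum_map_range, Finset.sum_Ico_eq_sum_range, Nat.add_sub_cancel_left]
  refine Finset.sum_congr rfl fun i hi => ?_
  simp only [Function.comp_apply]
  exact eval_rowPolyX Pt h (j0 + i) (by have := mem_range.1 hi; omega) u v t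

/-- Row-chunk validity of a part on values (composable). -/
def PChunkVal (Pt : SymPart) (j0 cnt : ℕ) (Dprev Dnext : SPoly) : Prop :=
  j0 + cnt ≤ Pt.V.m ∧ ∀ u v t : ℝ,
    eval Dnext u v t = eval Dprev u v t + ∑ j ∈ Finset.Ico j0 (j0 + cnt), rowValX Pt u v t j

/-- A term list with all coefficients zero evaluates to `0`. -/
theorem eval_eq_zero_of_allZero (p : SPoly) (h : allZero p = true) (u v t : ℝ) : eval p u v t = 0 := by
  induction p with
  | nil => simp [eval]
  | cons mc rest ih =>
    unfold allZero at h ih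
    simp only [List.all_cons, Bool.and_eq_true, beq_iff_eq] at h
    rw [SPoly.eval_cons, ih h.2, h.1]; simp

/-- A kernel part-chunk check gives chunk validity. -/
theorem pchunkVal_of_ok (Pt : SymPart) (h : partShapeOK Pt = true) (j0 cnt : ℕ) (Dprev Dnext : SPoly)
    (hk : partChunkOK Pt j0 cnt Dprev Dnext = true) : PChunkVal Pt j0 cnt Dprev Dnext := by
  unfold partChunkOK at hk
  simp only [Bool.and_eq_true, decide_eq_true_eq] at hk
  refine ⟨hk.1, fun u v t => ?_⟩
  have h0 := eval_eq_zero_of_allZero _ hk.2 u v t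
  rw [eval_mergeAll] at h0
  simp only [List.map_cons, List.map_nil, List.sum_cons, List.sum_nil, add_zero, eval_neg,
    eval_partRows Pt h j0 cnt hk.1] at h0
  linarith

/-- Consecutive part chunks compose. -/
theorem pchunkVal_trans (Pt : SymPart) (j0 c1 c2 : ℕ) (D0 D1 D2 : SPoly)
    (h1 : PChunkVal Pt j0 c1 D0 D1) (h2 : PChunkVal Pt (j0 + c1) c2 D1 D2) :
    PChunkVal Pt j0 (c1 + c2) D0 D2 := by
  refine ⟨by have := h2.1; omega, fun u v t => ?_⟩
  rw [h2.2 u v t, h1.2 u v t, add_assoc, ← add_assoc j0,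
    Finset.sum_Ico_consecutive _ (Nat.le_add_right j0 c1) (by omega)]

/-- Full validity of a part expansion: `eval T = Σ_{j<m} rowValX Pt j` everywhere. -/
def PartVal (Pt : SymPart) (T : SPoly) : Prop := ∀ u v t : ℝ, eval T u v t = ∑ j ∈ range Pt.V.m, rowValX Pt u v t j

/-- `PartVal` from a chunk validity covering all rows. -/
theorem partVal_of_chunk (Pt : SymPart) (T : SPoly) (h : PChunkVal Pt 0 Pt.V.m [] T) : PartVal Pt T := by
  intro u v t
  rw [h.2 u v t, eval_nil, zero_add, Nat.zero_add, Finset.range_eq_Ico]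

/-- Validity of a sum of parts: `eval T = Σ_parts Σ_j rowValX`. -/
def PartsVal (Ps : List SymPart) (T : SPoly) : Prop :=
  ∀ u v t : ℝ, eval T u v t = (Ps.map fun Pt => ∑ j ∈ range Pt.V.m, rowValX Pt u v t j).sum

/-- `PartsVal` from the validity of each part's expansion and a check that `T` is their concatenation's sum:
here simply: if `T = mergeAll Es` on values and each `E` is valid. -/
theorem partsVal_of_forall (Ps : List SymPart) (Es : List SPoly) (T : SPoly) (hlen : Ps.length = Es.length)
    (hE : ∀ i, i < Ps.length → PartVal (Ps.getD i ⟨false, [], [], ⟨[], []⟩, ⟨0, 0, 0, [], 0, []⟩⟩) (Es.getD i []))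
    (hT : ∀ u v t : ℝ, eval T u v t = (Es.map fun E => eval E u v t).sum) : PartsVal Ps T := by
  intro u v t
  rw [hT u v t]
  clear hT
  induction Ps generalizing Es with
  | nil => cases Es with | nil => simp | cons _ _ => simp at hlen
  | cons Pt Ps ih =>
    cases Es with
    | nil => simp at hlen
    | cons E Es =>
      simp only [List.map_cons, List.sum_cons]
      have h0 := hE 0 (by simp)
      simp only [List.getD_cons_zero] at h0
      rw [h0 u v t, ih Es (by simpa using hlen) (fun i hi => by simpa using hE (i + 1) (by simpa using hi))]

/-- Validity of a sum of parts accumulated on top of `D0`: `eval T = eval D0 + Σ_parts Σ_j rowValX`. -/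
def PartsValFrom (Ps : List SymPart) (D0 T : SPoly) : Prop :=
  ∀ u v t : ℝ, eval T u v t = eval D0 u v t + (Ps.map fun Pt => ∑ j ∈ range Pt.V.m, rowValX Pt u v t j).sum

/-- No parts left: the accumulator is the total. -/
theorem partsValFrom_last (D : SPoly) : PartsValFrom [] D D := fun u v t => by simp

/-- One more part: a full row-chunk validity of `Pt` from `D0` to `D1`, then the rest from `D1`. -/
theorem partsValFrom_cons (Pt : SymPart) (Ps : List SymPart) (D0 D1 T : SPoly) (c : ℕ) (hc : c = Pt.V.m)
    (h1 : PChunkVal Pt 0 c D0 D1) (h2 : PartsValFrom Ps D1 T) : PartsValFrom (Pt :: Ps) D0 T := by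
  intro u v t
  rw [h2 u v t, h1.2 u v t, Nat.zero_add, hc, ← Finset.range_eq_Ico]
  simp only [List.map_cons, List.sum_cons]
  ring

/-- `PartsVal` from an accumulation starting at `[]`. -/
theorem partsVal_of_from (Ps : List SymPart) (T : SPoly) (h : PartsValFrom Ps [] T) : PartsVal Ps T := by
  intro u v t
  rw [h u v t, eval_nil, zero_add]

/-- **The sums of squares are nonnegative**: `Σ_j rowValX Pt j ≥ 0` for a well-shaped part. -/
theorem partVal_nonneg (Pt : SymPart) (h : partShapeOK Pt = true) (u v t : ℝ) :
    0 ≤ ∑ j ∈ range Pt.V.m, rowValX Pt u v t j := by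
  obtain ⟨hL, hbs, hbs2⟩ := partShapeOK_spec Pt h
  have key : ∀ β : ℕ → ℝ, 0 ≤ ∑ j ∈ range Pt.V.m, ∑ l ∈ range Pt.V.m,
      ((Mrow Pt.V (Srows Pt.psd) Pt.psd.f j).getD l 0 : ℝ) * (β j * β l) := by
    intro β
    rw [quadM_eq Pt.V Pt.psd hL β β]
    refine psd_pairing Pt.psd hL.hp _ (fun a b => mul_comm _ _) fun g => ?_
    have e : ∑ i ∈ range Pt.psd.f, ∑ j ∈ range Pt.psd.f, g i * g j *
        ((∑ j' ∈ range Pt.V.m, (Pt.V.ent Pt.psd.f j' i : ℝ) * β j') *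
          ∑ l ∈ range Pt.V.m, (Pt.V.ent Pt.psd.f l j : ℝ) * β l) =
        (∑ i ∈ range Pt.psd.f, g i * ∑ j' ∈ range Pt.V.m, (Pt.V.ent Pt.psd.f j' i : ℝ) * β j') ^ 2 := by
      rw [sq, Finset.sum_mul_sum]
      refine Finset.sum_congr rfl fun i _ => Finset.sum_congr rfl fun j _ => ?_
      ring
    rw [e]; exact sq_nonneg _
  have key' : ∀ β : ℕ → ℝ, 0 ≤ ∑ j ∈ range Pt.V.m, β j * ∑ l ∈ range Pt.V.m,
      ((Mrow Pt.V (Srows Pt.psd) Pt.psd.f j).getD l 0 : ℝ) * β l := by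
    intro β
    have e : ∑ j ∈ range Pt.V.m, β j * ∑ l ∈ range Pt.V.m,
        ((Mrow Pt.V (Srows Pt.psd) Pt.psd.f j).getD l 0 : ℝ) * β l =
        ∑ j ∈ range Pt.V.m, ∑ l ∈ range Pt.V.m,
        ((Mrow Pt.V (Srows Pt.psd) Pt.psd.f j).getD l 0 : ℝ) * (β j * β l) := by
      refine Finset.sum_congr rfl fun j _ => ?_
      rw [Finset.mul_sum]
      exact Finset.sum_congr rfl fun l _ => by ring
    rw [e]; exact key β
  unfold rowValX
  by_cases htwo : Pt.two = true
  · simp only [htwo, if_true]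
    rw [Finset.sum_add_distrib, ← Finset.mul_sum]
    have k1 := key' fun l => eval (Pt.bs.getD l []) u v t
    have k2 := key' fun l => eval (Pt.bs2.getD l []) u v t
    positivity
  · simp only [htwo, Bool.false_eq_true, if_false]
    exact key' fun l => eval (Pt.bs.getD l []) u v t

end Summit.Ventures.PackingBounds.ThreePointCert

end
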